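import Literature.MathematicalPhysics.KineticTheory.DiPernaLionsVelocityAverages
import Literature.MathematicalPhysics.KineticTheory.VelocityAverageCompact
import Literature.MathematicalPhysics.KineticTheory.FreeTransportUniqueness
import Literature.MathematicalPhysics.KineticTheory.VelocityAveragingLocalization
import Literature.Analysis.FunctionSpaces.UnifIntegrableEgorov
import HarnessLib

/-!
# Reduction of CIP Lemma 5.3.9 to an equicontinuous family of averaged Duhamel integrals

Topic: MathematicalPhysics / KineticTheory. Seventh file of the Fourier-free proof of the `L¹`
velocity-averaging lemma (Cercignani–Illner–Pulvirenti 1994, Lemma 5.3.9,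
`velocityAverage_relativelyCompact_L1` of `VelocityAveraging`; see `VelocityAverageOperator` for
the plan). This file carries out the reductions of CIP pp. 154–155 quantitatively: under the
hypotheses of the lemma (`0 < T`), for every `ε > 0` there are `N`, a level `B`, a radius `R` and
measurable sources `Fₙ` with `|Fₙ| ≤ B`, supported in the ball of radius `R` of `ℝ × E × E`, such
that for all `n ≥ N` the velocity average `ρₙ = ∫ gₙ ψₙ dξ` is within `ε` in `L¹((0,T) × E)` of the
averaged Duhamel integral `A Fₙ = avgDuhamel 𝟙_{B̄(0,R)} T Fₙ` (`exists_avgDuhamel_near`):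

1. `ψₙ → ψ` (Egorov, `Literature.Analysis.FunctionSpaces.tendsto_integral_abs_mul_sub`), 2. cutoff to a compact box
   (`exists_slabBox_lintegral_compl_le`, `exists_smooth_slabCutoff`), 3. `ψ → ψₖ` smooth
   (`exists_smooth_approx_weight`, `Literature.Analysis.FunctionSpaces.eventually_forall_integral_abs_mul_sub_le`), 4. `fₙ = χψₖ gₙ`
   solves `T fₙ = Fₙ` on the whole space (`HasDistribTransportOn.cutoff`) hence
   `fₙ = sourceDuhamel Fₙ` (`ae_eq_sourceDuhamel_of_hasDistribTransportOn`), 5. truncation of `Fₙ`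
   at a level (`MeasureTheory.UniformIntegrable.spec`), the unbounded part contributing little in
   `L¹` (`lintegral_sourceDuhamel_le`), 6. identification of the velocity average of the bounded
   part with `A Fₙ^{≤}` (`avgDuhamel_eq_velocityIntegral_sourceDuhamel`).

The compactness of `{A Fₙ^{≤}}` (Kolmogorov–Riesz via `avgDuhamel_translate_modulus`) and the
extraction of the subsequence are in `VelocityAveragingProofs`. Everything is proved.

## References

* C. Cercignani, R. Illner, M. Pulvirenti, *The Mathematical Theory of Dilute Gases*, Springer
  (1994), §5.3, Lemma 5.3.9 and its proof, pp. 154–155. [CIPDiluteGases1994]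
-/

noncomputable section

open MeasureTheory Set Filter Function Metric
open _root_.Topology
open scoped ENNReal NNReal ContDiff

namespace Literature.MathematicalPhysics.KineticTheory

variable {E : Type*} [NormedAddCommGroup E] [InnerProductSpace ℝ E] [FiniteDimensional ℝ E]
  [MeasurableSpace E] [BorelSpace E]

/-! ## Velocity averages: integrability and weight changes -/

section Helpers

/-- The velocity average of `u ∈ L¹((0,T) × E × E)` against an a.e. bounded weight is integrable
on `(0,T) × E` (Fubini, `integrable_integral_velocity`). [folklore] -/
theorem integrable_velocityIntegral {T : ℝ} {u ψ : ℝ × E × E → ℝ} {M : ℝ}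
    (hu : Integrable u (slabMeasure E T)) (hψ : AEStronglyMeasurable ψ (slabMeasure E T))
    (hM : ∀ᵐ z ∂slabMeasure E T, |ψ z| ≤ M) :
    Integrable (velocityIntegral ψ u) (baseSlabMeasure E T) := by
  have hM' : ∀ᵐ z ∂slabMeasure E T, ‖ψ z‖ ≤ M := hM.mono fun z hz => (Real.norm_eq_abs _).le.trans hz
  exact (integrable_integral_velocity (hu.mul_bdd hψ hM')).1

/-- **Changing the weight**: `‖∫ u ψ₁ dξ - ∫ u ψ₂ dξ‖_{L¹((0,T) × E)} ≤ ∫ |u| |ψ₁ - ψ₂|` for a.e.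
bounded weights. [folklore] -/
theorem integral_abs_velocityIntegral_sub_weight_le {T : ℝ} {u ψ₁ ψ₂ : ℝ × E × E → ℝ} {M : ℝ}
    (hu : Integrable u (slabMeasure E T)) (hψ₁ : AEStronglyMeasurable ψ₁ (slabMeasure E T))
    (hψ₂ : AEStronglyMeasurable ψ₂ (slabMeasure E T)) (h₁ : ∀ᵐ z ∂slabMeasure E T, |ψ₁ z| ≤ M)
    (h₂ : ∀ᵐ z ∂slabMeasure E T, |ψ₂ z| ≤ M) :
    ∫ p, |velocityIntegral ψ₁ u p - velocityIntegral ψ₂ u p| ∂baseSlabMeasure E T ≤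
      ∫ z, |u z| * |ψ₁ z - ψ₂ z| ∂slabMeasure E T := by
  have h₁' : ∀ᵐ z ∂slabMeasure E T, ‖ψ₁ z‖ ≤ M := h₁.mono fun z hz => (Real.norm_eq_abs _).le.trans hz
  have h₂' : ∀ᵐ z ∂slabMeasure E T, ‖ψ₂ z‖ ≤ M := h₂.mono fun z hz => (Real.norm_eq_abs _).le.trans hz
  have hH₁ : Integrable (fun z => u z * ψ₁ z) (slabMeasure E T) := hu.mul_bdd hψ₁ h₁'
  have hH₂ : Integrable (fun z => u z * ψ₂ z) (slabMeasure E T) := hu.mul_bdd hψ₂ h₂'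
  have hae := integral_velocity_sub_ae hH₁ hH₂
  calc ∫ p, |velocityIntegral ψ₁ u p - velocityIntegral ψ₂ u p| ∂baseSlabMeasure E T
      = ∫ p : ℝ × E, |(∫ ξ : E, (u (p.1, p.2, ξ) * ψ₁ (p.1, p.2, ξ) - u (p.1, p.2, ξ) * ψ₂ (p.1, p.2, ξ)))|
          ∂baseSlabMeasure E T := by
        refine integral_congr_ae (hae.mono fun p hp => ?_)
        simp only [velocityIntegral] at hp ⊢
        rw [hp]
    _ ≤ ∫ z, |u z * ψ₁ z - u z * ψ₂ z| ∂slabMeasure E T := (integrable_integral_velocity (hH₁.sub hH₂)).2.1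
    _ = ∫ z, |u z| * |ψ₁ z - ψ₂ z| ∂slabMeasure E T := by
        refine integral_congr_ae (ae_of_all _ fun z => ?_)
        dsimp only
        rw [← mul_sub, abs_mul]

/-- The slab measure is dominated by Lebesgue measure restricted to `{t < T}`. [folklore] -/
theorem slabMeasure_le_restrict_lt (T : ℝ) :
    slabMeasure E T ≤ volume.restrict {z : ℝ × E × E | z.1 < T} := by
  rw [slabMeasure_def]
  exact Measure.restrict_mono (fun z hz => hz.1.2) le_rfl

/-- The slab measure is dominated by Lebesgue measure. [folklore] -/
theorem slabMeasure_le_volume (T : ℝ) : slabMeasure E T ≤ volume := by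
  rw [slabMeasure_def]; exact Measure.restrict_le_self

end Helpers

/-! ## The reduction -/

section Reduction

/-- **Reduction of CIP Lemma 5.3.9 to averaged Duhamel integrals of `L^∞` sources with common
compact support** (CIP 1994, pp. 154–155, steps "supported in a fixed compact set", "`ψₙ = ψ`",
"`ψ` smooth / `ψ = 1`", "`gₙ = uₙ + hₙ` with `T uₙ = Tgₙ·χ_{|Tgₙ|≤M}`", made quantitative): under
the hypotheses of `velocityAverage_relativelyCompact_L1` with `0 < T`, for every `ε > 0` there
are `N`, `B`, `R ≥ 0` and measurable sources `Fₙ`, `|Fₙ| ≤ B`, vanishing off the ball of radius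
`R`, such that for `n ≥ N` the velocity average `∫ gₙ ψₙ dξ` is `ε`-close in `L¹((0,T) × E)` to
`avgDuhamel 𝟙_{B̄(0,R)} T Fₙ`. [cite: CIPDiluteGases1994, §5.3 Lemma 5.3.9 (proof, pp. 154–155)] -/
theorem exists_avgDuhamel_near {T : ℝ} (hT : 0 < T) {g h ψ : ℕ → ℝ × E × E → ℝ}
    {ψlim : ℝ × E × E → ℝ}
    (hUI : UniformIntegrable g 1 (slabMeasure E T)) (hUT : UnifTight g 1 (slabMeasure E T))
    (hTr : ∀ n, HasDistribTransportOn (Ioo 0 T) (g n) (h n))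
    (hh : ∀ K ⊆ Ioo 0 T ×ˢ univ, IsCompact K → UniformIntegrable h 1 (volume.restrict K))
    (hψm : ∀ n, AEStronglyMeasurable (ψ n) (slabMeasure E T))
    (hψM : ∃ M : ℝ, ∀ n, ∀ᵐ z ∂slabMeasure E T, |ψ n z| ≤ M)
    (hψlim : ∀ᵐ z ∂slabMeasure E T, Tendsto (fun n => ψ n z) atTop (𝓝 (ψlim z)))
    {ε : ℝ} (hε : 0 < ε) :
    ∃ (N : ℕ) (B R : ℝ), 0 ≤ R ∧ ∃ F : ℕ → ℝ × E × E → ℝ,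
      (∀ n, Measurable (F n)) ∧ (∀ n z, |F n z| ≤ B) ∧ (∀ n z, R < ‖z‖ → F n z = 0) ∧
      ∀ n, N ≤ n →
        ∫ p, |velocityIntegral (ψ n) (g n) p -
          avgDuhamel ((closedBall (0 : E) R).indicator (fun _ => (1 : ℝ))) T (F n) p|
            ∂baseSlabMeasure E T ≤ ε := by
  ---- notation
  set μ : Measure (ℝ × E × E) := slabMeasure E T with hμ
  set ν : Measure (ℝ × E) := baseSlabMeasure E T with hν
  have hε4 : 0 < ε / 4 := by positivity
  ---- C0: basic facts on `g`, `ψ`, `ψlim`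
  have hgi : ∀ n, Integrable (g n) μ := integrable_of_uniformIntegrable hUI
  obtain ⟨Kg, hKg⟩ := exists_integral_abs_le_of_uniformIntegrable hUI
  obtain ⟨M₀, hM₀⟩ := hψM
  set M : ℝ := max M₀ 0 with hM_def
  have hM0 : 0 ≤ M := le_max_right _ _
  have hψM' : ∀ n, ∀ᵐ z ∂μ, |ψ n z| ≤ M := fun n => (hM₀ n).mono fun z hz => hz.trans (le_max_left _ _)
  have hψlm : AEStronglyMeasurable ψlim μ := aestronglyMeasurable_of_tendsto_ae atTop hψm hψlim
  have hψlM : ∀ᵐ z ∂μ, |ψlim z| ≤ M := by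
    have hall : ∀ᵐ z ∂μ, ∀ n, |ψ n z| ≤ M := ae_all_iff.2 hψM'
    filter_upwards [hψlim, hall] with z hz hzM
    exact le_of_tendsto ((continuous_abs.tendsto _).comp hz) (Eventually.of_forall hzM)
  ---- C1: Egorov, diagonal form
  have hE1 := Literature.Analysis.FunctionSpaces.tendsto_integral_abs_mul_sub hgi ⟨Kg, hKg⟩
    hUI.2.1 hUT hψm hψM' hψlim
  obtain ⟨N, hN⟩ := (Metric.tendsto_atTop.1 hE1) (ε / 4) hε4
  have hN' : ∀ n, N ≤ n → ∫ z, |g n z| * |ψ n z - ψlim z| ∂μ ≤ ε / 4 := fun n hn => by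
    have h := hN n hn
    rw [dist_zero_right, Real.norm_of_nonneg (integral_nonneg fun z => by positivity)] at h
    exact h.le
  ---- C2: the box and the cutoff
  have hεM : 0 < ε / (4 * (M + 1)) := by positivity
  obtain ⟨j, hj⟩ := exists_slabBox_lintegral_compl_le hT hUI.2.1 hUT hεM
  obtain ⟨χ, hχs, hχc, hχK, hχ1, hχ0, hχle⟩ := exists_smooth_slabCutoff (E := E) hT j
  set K₂ : Set (ℝ × E × E) := slabBox E T (j + 1) with hK₂
  have hK₂c : IsCompact K₂ := isCompact_slabBox T (j + 1)
  have hK₂m : MeasurableSet K₂ := measurableSet_slabBox T (j + 1)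
  have hK₂S : K₂ ⊆ Ioo 0 T ×ˢ univ := slabBox_subset hT (j + 1)
  ---- C3: smooth weights
  obtain ⟨ψs, hψss, hψsM, hψslim⟩ := exists_smooth_approx_weight hM0 hψlm hψlM
  have hψsm : ∀ k, AEStronglyMeasurable (ψs k) μ := fun k => (hψss k).continuous.aestronglyMeasurable
  have hE2 := Literature.Analysis.FunctionSpaces.eventually_forall_integral_abs_mul_sub_le hgi
    ⟨Kg, hKg⟩ hUI.2.1 hUT hψsm (fun k => ae_of_all _ (hψsM k)) hψslim hε4
  obtain ⟨k, hk⟩ := hE2.exists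
  -- the cutoff weight `θ = χ ψₖ` (kept opaque)
  obtain ⟨θ, hθ_def⟩ : ∃ θ : ℝ × E × E → ℝ, θ = fun z => χ z * ψs k z := ⟨_, rfl⟩
  have hθs : ContDiff ℝ ∞ θ := by rw [hθ_def]; exact hχs.mul (hψss k)
  have hθc : HasCompactSupport θ := by rw [hθ_def]; exact hχc.mul_right
  have hθK : tsupport θ ⊆ K₂ := by
    rw [hθ_def]; exact (tsupport_mul_subset_left).trans hχK
  have hθS : tsupport θ ⊆ Ioo 0 T ×ˢ univ := hθK.trans hK₂S
  have hθb : ∀ z, |θ z| ≤ M := fun z => by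
    rw [hθ_def]; simp only [abs_mul, abs_of_nonneg (hχ0 z)]
    calc χ z * |ψs k z| ≤ 1 * M := mul_le_mul (hχle z) (hψsM k z) (abs_nonneg _) zero_le_one
      _ = M := one_mul M
  obtain ⟨CT, hCT⟩ := (show Continuous (transportDeriv θ) by
      unfold transportDeriv
      exact (hθs.continuous_fderiv (by simp)).clm_apply (by fun_prop)).bounded_above_of_compact_support
    (hasCompactSupport_transportDeriv hθc)
  have hCT0 : 0 ≤ CT := (norm_nonneg _).trans (hCT 0)
  have hθ0 : ∀ z, z ∉ tsupport θ → θ z = 0 := fun z hz => image_eq_zero_of_notMem_tsupport hz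
  have hTθ0 : ∀ z, z ∉ tsupport θ → transportDeriv θ z = 0 := fun z hz =>
    transportDeriv_eq_zero_of_notMem_tsupport hz
  have hθm : Measurable θ := hθs.continuous.measurable
  have hTθm : Measurable (transportDeriv θ) := by
    refine Continuous.measurable ?_
    unfold transportDeriv
    exact (hθs.continuous_fderiv (by simp)).clm_apply (by fun_prop)
  ---- C4: measurable versions of `gₙ`, `hₙ`
  have hslab : MeasurableSet (Ioo (0 : ℝ) T ×ˢ (univ : Set (E × E))) :=
    measurableSet_Ioo.prod MeasurableSet.univ
  have hgam : ∀ n, AEStronglyMeasurable (g n) μ := fun n => by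
    rw [hμ, slabMeasure_def]; exact (hTr n).1.aestronglyMeasurable
  have hham : ∀ n, AEStronglyMeasurable (h n) μ := fun n => by
    rw [hμ, slabMeasure_def]; exact (hTr n).2.1.aestronglyMeasurable
  set g' : ℕ → ℝ × E × E → ℝ := fun n => (hgam n).mk (g n) with hg'
  set h' : ℕ → ℝ × E × E → ℝ := fun n => (hham n).mk (h n) with hh'
  have hg'm : ∀ n, Measurable (g' n) := fun n => (hgam n).stronglyMeasurable_mk.measurable
  have hh'm : ∀ n, Measurable (h' n) := fun n => (hham n).stronglyMeasurable_mk.measurable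
  have hgg' : ∀ n, g n =ᵐ[μ] g' n := fun n => (hgam n).ae_eq_mk
  have hhh' : ∀ n, h n =ᵐ[μ] h' n := fun n => (hham n).ae_eq_mk
  have hTr' : ∀ n, HasDistribTransportOn (Ioo 0 T) (g' n) (h' n) := fun n => by
    refine (hTr n).congr_ae measurableSet_Ioo ?_ ?_
    · rw [← slabMeasure_def]; exact hgg' n
    · rw [← slabMeasure_def]; exact hhh' n
  have hg'i : ∀ n, Integrable (g' n) μ := fun n => (hgi n).congr (hgg' n)
  ---- C5: the cut-off solutions `fₙ = θ g'ₙ`, `T fₙ = Fₙ`, and `fₙ = sourceDuhamel Fₙ`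
  set f : ℕ → ℝ × E × E → ℝ := fun n z => θ z * g' n z with hf_def
  set F : ℕ → ℝ × E × E → ℝ := fun n z => θ z * h' n z + g' n z * transportDeriv θ z with hF_def
  have hcut : ∀ n, HasDistribTransportOn univ (f n) (F n) ∧ Integrable (f n) volume ∧
      Integrable (F n) volume := fun n => (hTr' n).cutoff hθs hθc hθS
  have hFm : ∀ n, Measurable (F n) := fun n =>
    ((hθm.mul (hh'm n)).add ((hg'm n).mul hTθm))
  have hfm : ∀ n, Measurable (f n) := fun n => hθm.mul (hg'm n)
  have hnot : ∀ z : ℝ × E × E, z.1 ≤ 0 → z ∉ tsupport θ := fun z hz h =>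
    absurd (hθS h).1.1 (not_lt.2 hz)
  have hf0 : ∀ n z, z.1 ≤ (0 : ℝ) → f n z = 0 := fun n z hz => by
    rw [hf_def]; simp only; rw [hθ0 z (hnot z hz), zero_mul]
  have hF0 : ∀ n z, z.1 ≤ (0 : ℝ) → F n z = 0 := fun n z hz => by
    rw [hF_def]; simp only
    rw [hθ0 z (hnot z hz), hTθ0 z (hnot z hz), zero_mul, mul_zero, add_zero]
  have hF0' : ∀ n z, z ∉ tsupport θ → F n z = 0 := fun n z hz => by
    rw [hF_def]; simp only; rw [hθ0 z hz, hTθ0 z hz, zero_mul, mul_zero, add_zero]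
  have hfD : ∀ n, f n =ᵐ[volume] sourceDuhamel (F n) := fun n =>
    ae_eq_sourceDuhamel_of_hasDistribTransportOn (hcut n).2.1.locallyIntegrable (hFm n) (hcut n).2.2
      (ae_of_all _ (hf0 n)) (hF0 n) (hcut n).1
  ---- C6: uniform integrability of `(Fₙ)` on `K₂` and the truncation level
  have hK₂vol : UniformIntegrable F 1 (volume.restrict K₂) := by
    have hUh : UniformIntegrable h' 1 (volume.restrict K₂) := by
      refine (hh K₂ hK₂S hK₂c).ae_eq fun n => ?_
      have := hhh' n
      rw [hμ, slabMeasure_def] at this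
      exact ae_restrict_of_ae_restrict_of_subset hK₂S this
    have hUg : UniformIntegrable g' 1 (volume.restrict K₂) := by
      have h1 : UniformIntegrable g 1 (volume.restrict K₂) := by
        have := hUI; rw [hμ, slabMeasure_def] at this
        exact uniformIntegrable_restrict_mono this hK₂m hK₂S
      refine h1.ae_eq fun n => ?_
      have := hgg' n
      rw [hμ, slabMeasure_def] at this
      exact ae_restrict_of_ae_restrict_of_subset hK₂S this
    refine uniformIntegrable_of_ae_le_mul_add hUh hUg (fun n => (hFm n).aestronglyMeasurable)
      (c := max M CT) (le_max_of_le_left hM0) fun n => ae_of_all _ fun z => ?_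
    rw [hF_def]; simp only [Real.norm_eq_abs]
    calc |θ z * h' n z + g' n z * transportDeriv θ z|
        ≤ |θ z| * |h' n z| + |g' n z| * |transportDeriv θ z| := by
          refine (abs_add_le _ _).trans ?_; rw [abs_mul, abs_mul]
      _ ≤ max M CT * |h' n z| + |g' n z| * max M CT := by
          gcongr
          · exact (hθb z).trans (le_max_left _ _)
          · exact ((Real.norm_eq_abs _).symm.le.trans (hCT z)).trans (le_max_right _ _)
      _ = max M CT * (|h' n z| + |g' n z|) := by ring
  have hε3 : 0 < ε / (4 * T + 4) := by positivity
  obtain ⟨C, hC⟩ := hK₂vol.spec one_ne_zero ENNReal.one_ne_top hε3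
  -- the truncated sources
  set Fgt : ℕ → ℝ × E × E → ℝ := fun n => {z | C ≤ ‖F n z‖₊}.indicator (F n) with hFgt
  set Fle : ℕ → ℝ × E × E → ℝ := fun n z => F n z - Fgt n z with hFle
  have hlev : ∀ n, MeasurableSet {z | C ≤ ‖F n z‖₊} := fun n =>
    measurableSet_le measurable_const (hFm n).nnnorm
  have hFgtm : ∀ n, Measurable (Fgt n) := fun n => (hFm n).indicator (hlev n)
  have hFlem : ∀ n, Measurable (Fle n) := fun n => (hFm n).sub (hFgtm n)
  have hFleb : ∀ n z, |Fle n z| ≤ C := fun n z => by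
    rw [hFle, hFgt]; simp only
    by_cases hz : z ∈ {z | C ≤ ‖F n z‖₊}
    · rw [indicator_of_mem hz, sub_self, abs_zero]; exact C.coe_nonneg
    · rw [indicator_of_notMem hz, sub_zero]
      rw [mem_setOf_eq, not_le] at hz
      have : ‖F n z‖ < C := hz
      rw [Real.norm_eq_abs] at this
      exact this.le
  -- supports: everything lives in `K₂ ⊆ B̄(0, R)`
  set R : ℝ := max T ((j : ℝ) + 2) with hR_def
  have hR0 : 0 ≤ R := hT.le.trans (le_max_left _ _)
  have hK₂R : ∀ z ∈ K₂, ‖z‖ ≤ R := fun z hz => by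
    rw [hK₂, mem_slabBox] at hz
    rw [norm_phase_le_iff]
    have h3 : (0 : ℝ) < (j + 1 : ℕ) + 3 := by positivity
    have ht0 : 0 ≤ T / ((j + 1 : ℕ) + 3) := (div_pos hT h3).le
    refine ⟨?_, ?_, ?_⟩
    · rw [abs_le]; constructor <;> [skip; skip] <;> nlinarith [hz.1.1, hz.1.2, le_max_left T ((j:ℝ) + 2)]
    · calc ‖z.2.1‖ ≤ ‖z.2‖ := norm_fst_le z.2
        _ ≤ (j + 1 : ℕ) + 1 := hz.2
        _ = (j : ℝ) + 2 := by push_cast; ring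
        _ ≤ R := le_max_right _ _
    · calc ‖z.2.2‖ ≤ ‖z.2‖ := norm_snd_le z.2
        _ ≤ (j + 1 : ℕ) + 1 := hz.2
        _ = (j : ℝ) + 2 := by push_cast; ring
        _ ≤ R := le_max_right _ _
  have hFR : ∀ n z, R < ‖z‖ → F n z = 0 := fun n z hz =>
    hF0' n z fun h => (hK₂R z (hθK h)).not_gt hz
  have hFgtR : ∀ n z, R < ‖z‖ → Fgt n z = 0 := fun n z hz => by
    rw [hFgt]; simp only; exact indicator_apply_eq_zero.2 fun _ => hFR n z hz
  have hFleR : ∀ n z, R < ‖z‖ → Fle n z = 0 := fun n z hz => by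
    rw [hFle]; simp only; rw [hFR n z hz, hFgtR n z hz, sub_zero]
  have hFgt0 : ∀ n z, z.1 ≤ (0 : ℝ) → Fgt n z = 0 := fun n z hz => by
    rw [hFgt]; simp only; exact indicator_apply_eq_zero.2 fun _ => hF0 n z hz
  have hFle0 : ∀ n z, z.1 ≤ (0 : ℝ) → Fle n z = 0 := fun n z hz => by
    rw [hFle]; simp only; rw [hF0 n z hz, hFgt0 n z hz, sub_zero]
  -- integrability and the `L¹` smallness of the unbounded part
  have hFgti : ∀ n, Integrable (Fgt n) volume := fun n => (hcut n).2.2.indicator (hlev n)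
  have hFlei : ∀ n, Integrable (Fle n) volume := fun n => (hcut n).2.2.sub (hFgti n)
  have hFgt1 : ∀ n, ∫⁻ z, ‖Fgt n z‖ₑ ∂volume ≤ ENNReal.ofReal (ε / (4 * T + 4)) := fun n => by
    have h1 := hC n
    have hsupp : Function.support (Fgt n) ⊆ K₂ := fun z hz => by
      by_contra hzK
      exact hz (indicator_apply_eq_zero.2 fun _ => hF0' n z fun h => hzK (hθK h))
    rw [← eLpNorm_one_eq_lintegral_enorm, ← eLpNorm_restrict_eq_of_support_subset hsupp]
    exact h1
  ---- C7: the Duhamel integrals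
  set u : ℕ → ℝ × E × E → ℝ := fun n => sourceDuhamel (F n) with hu_def
  set ule : ℕ → ℝ × E × E → ℝ := fun n => sourceDuhamel (Fle n) with hule
  set ugt : ℕ → ℝ × E × E → ℝ := fun n => sourceDuhamel (Fgt n) with hugt
  have hsplit : ∀ n, u n =ᵐ[volume] ule n + ugt n := fun n => by
    have e : F n = fun z => Fle n z + Fgt n z := by funext z; rw [hFle]; simp only; ring
    have := sourceDuhamel_add_ae (hFlem n) (hFlei n) (hFgtm n) (hFgti n) (hFle0 n) (hFgt0 n)
    rw [hu_def]; simp only; rw [e]; exact this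
  have hui : ∀ n, Integrable (u n) μ := fun n =>
    ((integrableOn_sourceDuhamel (hFm n) (hcut n).2.2 (hF0 n) T).integrable.mono_measure
      (slabMeasure_le_restrict_lt T))
  have hulei : ∀ n, Integrable (ule n) μ := fun n =>
    ((integrableOn_sourceDuhamel (hFlem n) (hFlei n) (hFle0 n) T).integrable.mono_measure
      (slabMeasure_le_restrict_lt T))
  have hugti : ∀ n, Integrable (ugt n) μ := fun n =>
    ((integrableOn_sourceDuhamel (hFgtm n) (hFgti n) (hFgt0 n) T).integrable.mono_measure
      (slabMeasure_le_restrict_lt T))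
  have hugt1 : ∀ n, ∫ z, |ugt n z| ∂μ ≤ ε / 4 := fun n => by
    have h1 := lintegral_sourceDuhamel_le (hFgtm n) (hFgt0 n) T
    rw [sub_zero] at h1
    have h2 : ∫⁻ z, ‖ugt n z‖ₑ ∂μ ≤ ENNReal.ofReal T * ENNReal.ofReal (ε / (4 * T + 4)) :=
      (lintegral_mono' (slabMeasure_le_restrict_lt T) le_rfl).trans (h1.trans
        (mul_le_mul' le_rfl (hFgt1 n)))
    rw [integral_eq_lintegral_of_nonneg_ae (ae_of_all _ fun z => abs_nonneg _)
      (hugti n).abs.aestronglyMeasurable]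
    have h3 : ∫⁻ z, ENNReal.ofReal |ugt n z| ∂μ = ∫⁻ z, ‖ugt n z‖ₑ ∂μ :=
      lintegral_congr fun z => by rw [← Real.enorm_eq_ofReal_abs]
    rw [h3]
    refine (ENNReal.toReal_mono (ENNReal.mul_ne_top ENNReal.ofReal_ne_top ENNReal.ofReal_ne_top) h2).trans ?_
    rw [← ENNReal.ofReal_mul hT.le, ENNReal.toReal_ofReal (by positivity)]
    rw [mul_div_assoc']
    rw [div_le_div_iff₀ (by positivity) (by positivity)]
    nlinarith
  ---- C8: the averaged Duhamel integrals of the bounded parts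
  set ψ₀ : E → ℝ := (closedBall (0 : E) R).indicator fun _ => (1 : ℝ) with hψ₀
  have hw : ∀ n (p : ℝ × E), p.1 < T →
      avgDuhamel ψ₀ T (Fle n) p = velocityIntegral (fun _ => (1 : ℝ)) (ule n) p := by
    intro n p hp
    rw [avgDuhamel_eq_velocityIntegral_sourceDuhamel (hFle0 n) (by linarith : p.1 - 0 ≤ T)]
    simp only [velocityIntegral]
    refine integral_congr_ae (ae_of_all _ fun ξ => ?_)
    dsimp only
    by_cases hξ : ξ ∈ closedBall (0 : E) R
    · rw [hψ₀, indicator_of_mem hξ]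
    · have h0 : sourceDuhamel (Fle n) (p.1, p.2, ξ) = 0 := by
        rw [sourceDuhamel_apply]
        refine integral_eq_zero_of_ae (ae_of_all _ fun s => hFleR n _ ?_)
        rw [mem_closedBall_zero_iff, not_le] at hξ
        refine hξ.trans_le ?_
        simp only [shear, Prod.norm_def]
        exact le_max_of_le_right (le_max_right _ _)
      rw [hule]; simp only; rw [h0, zero_mul, zero_mul]
  ---- C9: the chain of approximations
  refine ⟨N, C, R, hR0, Fle, hFlem, hFleb, hFleR, fun n hn => ?_⟩
  show ∫ p, |velocityIntegral (ψ n) (g n) p - avgDuhamel ψ₀ T (Fle n) p| ∂ν ≤ ε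
  -- the intermediate velocity averages
  have hχam : AEStronglyMeasurable χ μ := hχs.continuous.aestronglyMeasurable
  have hχgi : Integrable (fun z => χ z * g n z) μ :=
    (hgi n).bdd_mul hχam (c := 1) (ae_of_all _ fun z => by
      rw [Real.norm_eq_abs, abs_of_nonneg (hχ0 z)]; exact hχle z)
  have h1M : ∀ᵐ z ∂μ, |(fun _ : ℝ × E × E => (1 : ℝ)) z| ≤ 1 := ae_of_all _ fun z => by simp
  have h1m : AEStronglyMeasurable (fun _ : ℝ × E × E => (1 : ℝ)) μ := aestronglyMeasurable_const
  -- (i) `ψₙ → ψlim`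
  have e1 : ∫ p, |velocityIntegral (ψ n) (g n) p - velocityIntegral ψlim (g n) p| ∂ν ≤ ε / 4 :=
    (integral_abs_velocityIntegral_sub_weight_le (hgi n) (hψm n) hψlm (hψM' n) hψlM).trans (hN' n hn)
  -- (ii) cutoff
  have e2 : ∫ p, |velocityIntegral ψlim (g n) p - velocityIntegral ψlim (fun z => χ z * g n z) p| ∂ν
      ≤ ε / 4 := by
    refine (integral_abs_velocityIntegral_sub_le hψlm hψlM (hgi n) hχgi).trans ?_
    have hb : ∫ z, |g n z - χ z * g n z| ∂μ ≤ ∫ z in (slabBox E T j)ᶜ, |g n z| ∂μ := by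
      rw [← integral_indicator (measurableSet_slabBox T j).compl]
      refine integral_mono_of_nonneg (ae_of_all _ fun z => abs_nonneg _)
        (((hgi n).abs).indicator (measurableSet_slabBox T j).compl) (ae_of_all _ fun z => ?_)
      dsimp only
      by_cases hz : z ∈ slabBox E T j
      · rw [indicator_of_notMem (fun h => Set.notMem_of_mem_compl h hz), hχ1 z hz, one_mul, sub_self,
          abs_zero]
      · rw [indicator_of_mem hz]
        have : g n z - χ z * g n z = (1 - χ z) * g n z := by ring
        rw [this, abs_mul, abs_of_nonneg (by linarith [hχle z])]
        calc (1 - χ z) * |g n z| ≤ 1 * |g n z| :=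
              mul_le_mul_of_nonneg_right (by linarith [hχ0 z]) (abs_nonneg _)
          _ = |g n z| := one_mul _
    have hc : ∫ z in (slabBox E T j)ᶜ, |g n z| ∂μ ≤ ε / (4 * (M + 1)) := by
      rw [integral_eq_lintegral_of_nonneg_ae (ae_of_all _ fun z => abs_nonneg _)
        (hgi n).abs.aestronglyMeasurable.restrict]
      have h3 : ∫⁻ z in (slabBox E T j)ᶜ, ENNReal.ofReal |g n z| ∂μ =
          ∫⁻ z in (slabBox E T j)ᶜ, ‖g n z‖ₑ ∂μ :=
        lintegral_congr fun z => by rw [← Real.enorm_eq_ofReal_abs]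
      rw [h3]
      exact ENNReal.toReal_le_of_le_ofReal (by positivity) (hj n)
    calc M * ∫ z, |g n z - χ z * g n z| ∂μ ≤ M * (ε / (4 * (M + 1))) :=
          mul_le_mul_of_nonneg_left (hb.trans hc) hM0
      _ ≤ ε / 4 := by
          rw [mul_div_assoc', div_le_div_iff₀ (by positivity) (by positivity)]
          nlinarith
  -- (iii) `ψlim → ψₖ`
  have e3 : ∫ p, |velocityIntegral ψlim (fun z => χ z * g n z) p -
      velocityIntegral (ψs k) (fun z => χ z * g n z) p| ∂ν ≤ ε / 4 := by
    refine (integral_abs_velocityIntegral_sub_weight_le hχgi hψlm (hψsm k) hψlM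
      (ae_of_all _ (hψsM k))).trans (le_trans ?_ (hk n))
    have hdm : AEStronglyMeasurable (fun z => |ψs k z - ψlim z|) μ := ((hψsm k).sub hψlm).norm.congr
      (ae_of_all _ fun z => Real.norm_eq_abs _)
    have hri : Integrable (fun z => |g n z| * |ψs k z - ψlim z|) μ := by
      refine (hgi n).abs.mul_bdd hdm (c := M + M) ?_
      filter_upwards [hψlM] with z hz
      rw [Real.norm_eq_abs, abs_abs]
      calc |ψs k z - ψlim z| ≤ |ψs k z| + |ψlim z| := abs_sub _ _
        _ ≤ M + M := add_le_add (hψsM k z) hz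
    refine integral_mono_of_nonneg (ae_of_all _ fun z => by positivity) hri (ae_of_all _ fun z => ?_)
    dsimp only
    rw [abs_mul, abs_of_nonneg (hχ0 z), abs_sub_comm (ψlim z)]
    calc χ z * |g n z| * |ψs k z - ψlim z| ≤ 1 * |g n z| * |ψs k z - ψlim z| := by
          gcongr; exact hχle z
      _ = |g n z| * |ψs k z - ψlim z| := by rw [one_mul]
  -- (iv) `∫ (χ gₙ) ψₖ dξ = ∫ (θ gₙ) · 1 dξ` identically
  have e4 : velocityIntegral (ψs k) (fun z => χ z * g n z) =
      velocityIntegral (fun _ => (1 : ℝ)) (fun z => θ z * g n z) := by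
    funext p
    simp only [velocityIntegral]
    refine integral_congr_ae (ae_of_all _ fun ξ => ?_)
    rw [hθ_def]; simp only; ring
  -- (v) `gₙ → g'ₙ` (a.e. equal)
  have hθgi : Integrable (fun z => θ z * g n z) μ :=
    (hgi n).bdd_mul hθs.continuous.aestronglyMeasurable (c := M)
      (ae_of_all _ fun z => (Real.norm_eq_abs _).le.trans (hθb z))
  have hfi : Integrable (f n) μ := (hcut n).2.1.mono_measure (slabMeasure_le_volume T)
  have e5 : ∫ p, |velocityIntegral (fun _ => (1 : ℝ)) (fun z => θ z * g n z) p -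
      velocityIntegral (fun _ => (1 : ℝ)) (f n) p| ∂ν ≤ 0 := by
    refine (integral_abs_velocityIntegral_sub_le h1m h1M hθgi hfi).trans ?_
    rw [one_mul, integral_eq_zero_of_ae]
    filter_upwards [hgg' n] with z hz
    rw [hf_def]; simp only; rw [hz, sub_self, abs_zero]; rfl
  -- (vi) `fₙ = sourceDuhamel Fₙ` a.e.
  have hμvol : μ ≪ volume := Measure.absolutelyContinuous_of_le (slabMeasure_le_volume T)
  have e6 : ∫ p, |velocityIntegral (fun _ => (1 : ℝ)) (f n) p -
      velocityIntegral (fun _ => (1 : ℝ)) (u n) p| ∂ν ≤ 0 := by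
    refine (integral_abs_velocityIntegral_sub_le h1m h1M hfi (hui n)).trans ?_
    rw [one_mul, integral_eq_zero_of_ae]
    filter_upwards [hμvol.ae_eq (hfD n)] with z hz
    rw [hu_def]; simp only; rw [hz, sub_self, abs_zero]; rfl
  -- (vii) removing the unbounded part of the source
  have e7 : ∫ p, |velocityIntegral (fun _ => (1 : ℝ)) (u n) p -
      velocityIntegral (fun _ => (1 : ℝ)) (ule n) p| ∂ν ≤ ε / 4 := by
    refine (integral_abs_velocityIntegral_sub_le h1m h1M (hui n) (hulei n)).trans ?_
    rw [one_mul]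
    refine le_trans (le_of_eq (integral_congr_ae ?_)) (hugt1 n)
    filter_upwards [hμvol.ae_eq (hsplit n)] with z hz
    rw [hz, Pi.add_apply, add_sub_cancel_left]
  -- (viii) the bounded part is an averaged Duhamel integral, a.e. on the base slab
  have e8 : ∫ p, |velocityIntegral (fun _ => (1 : ℝ)) (ule n) p - avgDuhamel ψ₀ T (Fle n) p| ∂ν ≤ 0 := by
    rw [integral_eq_zero_of_ae]
    have hmem : ∀ᵐ p ∂ν, p ∈ Ioo (0 : ℝ) T ×ˢ (univ : Set E) := by
      rw [hν, baseSlabMeasure_def]; exact ae_restrict_mem (measurableSet_Ioo.prod MeasurableSet.univ)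
    filter_upwards [hmem] with p hp
    rw [hw n p hp.1.2, sub_self, abs_zero]; rfl
  ---- integrability of all intermediate averages on the base slab
  have i0 : Integrable (velocityIntegral (ψ n) (g n)) ν := integrable_velocityIntegral (hgi n) (hψm n) (hψM' n)
  have i1 : Integrable (velocityIntegral ψlim (g n)) ν := integrable_velocityIntegral (hgi n) hψlm hψlM
  have i2 : Integrable (velocityIntegral ψlim (fun z => χ z * g n z)) ν :=
    integrable_velocityIntegral hχgi hψlm hψlM
  have i3 : Integrable (velocityIntegral (ψs k) (fun z => χ z * g n z)) ν :=
    integrable_velocityIntegral hχgi (hψsm k) (ae_of_all _ (hψsM k))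
  have i4 : Integrable (velocityIntegral (fun _ => (1 : ℝ)) (fun z => θ z * g n z)) ν :=
    integrable_velocityIntegral hθgi h1m h1M
  have i5 : Integrable (velocityIntegral (fun _ => (1 : ℝ)) (f n)) ν := integrable_velocityIntegral hfi h1m h1M
  have i6 : Integrable (velocityIntegral (fun _ => (1 : ℝ)) (u n)) ν := integrable_velocityIntegral (hui n) h1m h1M
  have i7 : Integrable (velocityIntegral (fun _ => (1 : ℝ)) (ule n)) ν :=
    integrable_velocityIntegral (hulei n) h1m h1M
  have i8 : Integrable (avgDuhamel ψ₀ T (Fle n)) ν := by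
    have hψ₀m : Measurable ψ₀ := measurable_const.indicator measurableSet_closedBall
    have hψ₀i : Integrable ψ₀ volume :=
      integrable_of_bounded_of_eq_zero hψ₀m.aestronglyMeasurable (C := 1) (fun ξ => by
          rw [hψ₀]; by_cases hξ : ξ ∈ closedBall (0 : E) R <;> simp [hξ])
        (isCompact_closedBall (0 : E) R).measure_lt_top (fun ξ hξ => by
          rw [hψ₀]; exact indicator_of_notMem hξ _)
    have hm : AEStronglyMeasurable (avgDuhamel ψ₀ T (Fle n)) volume :=
      (stronglyMeasurable_avgDuhamel hψ₀m (hFlem n)).aestronglyMeasurable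
    have hb : ∀ p, |avgDuhamel ψ₀ T (Fle n) p| ≤ (∫ ξ, |ψ₀ ξ|) * (T * C) := fun p =>
      abs_avgDuhamel_le hψ₀i hT.le (hFleb n) p
    have h0 : ∀ p, p ∉ closedBall (0 : ℝ × E) (R + T + T * R) → avgDuhamel ψ₀ T (Fle n) p = 0 :=
      fun p hp => avgDuhamel_eq_zero_of_norm_gt hR0 (hFleR n) hT.le
        (by rw [mem_closedBall_zero_iff, not_le] at hp; exact hp)
    have hint : Integrable (avgDuhamel ψ₀ T (Fle n)) volume :=
      integrable_of_bounded_of_eq_zero hm hb (isCompact_closedBall _ _).measure_lt_top h0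
    rw [hν, baseSlabMeasure_def]
    exact hint.mono_measure Measure.restrict_le_self
  ---- the triangle inequality
  have tri : ∀ {a b c : ℝ × E → ℝ}, Integrable a ν → Integrable b ν → Integrable c ν →
      ∫ p, |a p - c p| ∂ν ≤ (∫ p, |a p - b p| ∂ν) + ∫ p, |b p - c p| ∂ν := by
    intro a b c ha hb hc
    have h1 : Integrable (fun p => |a p - b p|) ν := (ha.sub hb).abs
    have h2 : Integrable (fun p => |b p - c p|) ν := (hb.sub hc).abs
    rw [← integral_add h1 h2]
    exact integral_mono_of_nonneg (ae_of_all _ fun p => abs_nonneg _) (h1.add h2)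
      (ae_of_all _ fun p => abs_sub_le _ _ _)
  rw [e4] at e3 i3
  calc ∫ p, |velocityIntegral (ψ n) (g n) p - avgDuhamel ψ₀ T (Fle n) p| ∂ν
      ≤ (∫ p, |velocityIntegral (ψ n) (g n) p - velocityIntegral ψlim (g n) p| ∂ν) +
          ∫ p, |velocityIntegral ψlim (g n) p - avgDuhamel ψ₀ T (Fle n) p| ∂ν := tri i0 i1 i8
    _ ≤ ε / 4 + (ε / 4 + (ε / 4 + (0 + (0 + (ε / 4 + 0))))) := by
        gcongr
        refine (tri i1 i2 i8).trans (add_le_add e2 ?_)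
        refine (tri i2 i4 i8).trans (add_le_add e3 ?_)
        refine (tri i4 i5 i8).trans (add_le_add e5 ?_)
        refine (tri i5 i6 i8).trans (add_le_add e6 ?_)
        refine (tri i6 i7 i8).trans (add_le_add e7 ?_)
        exact e8
    _ = ε := by ring

end Reduction

end Literature.MathematicalPhysics.KineticTheory
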